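import Mathlib
import Summits.BirchSwinnertonDyer.BirchSwinnertonDyer.Theorems.GenusKolyvaginAtTwoPowDvdShaCardAtTwoRTNonPhantomCocycleBasis

/-!
# Route `GenusKolyvaginAtTwo`, crux L_T `PowDvdShaCardAtTwoRT` (stmt-BirchSwinnertonDyer-23242), LINE 18 stub L, bottom rung:
# the NON-PHANTOM lemma at every level `2^L` — (A) powers of an element killed by a cocycle; arithmetic in a basis modulo `q`

Seat `bsd-line-gk2-p3` g22 (PROVER 3/3, cell `bsd-f1-sign2`), `--supports stmt-BirchSwinnertonDyer-23242` (helper).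
THEOREMS ONLY (no definition, no named fact, no `sorry`). BSD is not proved by any of this; neither is the crux.
File 1 of 4 (`…RTNonPhantomPowBasis` → `…RTNonPhantomPowLayers` → `…RTNonPhantomPowCore` → `…RTNonPhantomPowCoboundary`).

WHY (series `…RTNonPhantomPow*`, the ALL-LEVELS sequel of files (I)–(VII) `…RTNonPhantom*`). The bottom-rung ENGINE of LINE 18
(LEAD gk2-p1, `RelaxedCount.false_of_bottomRung_engine(_cheb)`, `hres_of_nonPhantom_pow`) feeds the full-order PAIR Čebotarev at
EVERY level `2^M`, whose separation hypothesis `hres` asks that no non-zero class of the span `⟨c(n), res_K y⟩ ≤ H¹(K, E[2^M])`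
dies on `Γ_{K(E[2^M])}` (NON-PHANTOM).  Files (I)–(VII) settled level `4`; this series proves the group-theoretic input at every
level: **for `Γ ↠ GL₂(ℤ/2^L)` the restriction `H¹(Γ/ker, (ℤ/2^L)²) → H¹(⟨u⟩, (ℤ/2^L)²)` to the cyclic group of the Tate
transvection `u = (1 1; 0 1)` is injective** (Lawson–Wuthrich 2016 §7.1/§8 compute these `H¹` to be `ℤ/2` for `L ≥ 2`; the
inertia group of an odd multiplicative prime with `ord_p Δ` odd supplies `u`, and the Kummer condition there makes Selmer
classes principal on `u`).  Phrased for an abstract group `Γ` acting on an abstract additive group `M` through a `1`-cocycle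
`φ : Γ → M` vanishing on the kernel of the action; `P₁, P₂` a pair spanning `M` freely modulo `q = 2^L`.

THIS FILE: §1 `φ (g^k) = 0`, `φ (g^z) = 0` once `φ g = 0`; §2 arithmetic in a pair `P₁, P₂` spanning `M` freely modulo `q`
(congruent coefficients, parity of coefficients of `2`-torsion / `2`-divisible elements, elements of a layer `1 + 2^i M₂` fix
`M[2]`, `M^{u,ℓ} = 0`, `(r²)` has no fixed `2`-torsion vector). The level-free generalities of file (I)
`…RTNonPhantomCocycleBasis` are imported, not restated.

References: T. Lawson, C. Wuthrich, *Vanishing of some Galois cohomology groups for elliptic curves*, Springer Proc. Math.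
Stat. 188 (2016), §7.1 and §8; J.-P. Serre, *Abelian ℓ-adic representations* (1968), IV A.1.2 (Tate transvection);
B. H. Gross, *Kolyvagin's work on modular elliptic curves* (1991), Prop. 9.1 (the odd-`p` analogue).
-/

-- `Summit.<P>.<Sub>` repeats `BirchSwinnertonDyer` by the tree's layout convention (D-0017)
set_option linter.dupNamespace false
set_option autoImplicit false

open Summit.BirchSwinnertonDyer.BirchSwinnertonDyer.Theorems.GenusExact.NonPhantom (smul_zsmul_comm cocycle_one
  cocycle_inv cocycle_eq_of_forall_smul_eq cocycle_conj cocycle_mul_of_eq_zero_right cocycle_mul_of_eq_zero_left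
  cocycle_sub_coboundary ker_sub_coboundary smul_lincomb forall_smul_eq_of_basis forall_smul_eq_self_of_basis
  exists_eq_two_smul_of_smul_eq)

namespace Summit.BirchSwinnertonDyer.BirchSwinnertonDyer.Theorems.GenusExact.NonPhantomPow

variable {Γ : Type*} [Group Γ] {M : Type*} [AddCommGroup M] [DistribMulAction Γ M]

/-! ## §1 Powers -/

/-- A cocycle killing `g` kills every power `g ^ k`. [folklore] -/
theorem cocycle_pow_of_eq_zero {φ : Γ → M} (hφ : ∀ g h, φ (g * h) = φ g + g • φ h) {g : Γ}
    (hg : φ g = 0) (k : ℕ) : φ (g ^ k) = 0 := by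
  induction k with
  | zero => rw [pow_zero]; exact cocycle_one hφ
  | succ k ih => rw [pow_succ, hφ, ih, hg, smul_zero, add_zero]

/-- A cocycle killing `g` kills every integer power `g ^ k`. [folklore] -/
theorem cocycle_zpow_of_eq_zero {φ : Γ → M} (hφ : ∀ g h, φ (g * h) = φ g + g • φ h) {g : Γ}
    (hg : φ g = 0) (k : ℤ) : φ (g ^ k) = 0 := by
  rcases Int.eq_nat_or_neg k with ⟨n, rfl | rfl⟩
  · rw [zpow_natCast]; exact cocycle_pow_of_eq_zero hφ hg n
  · rw [zpow_neg, zpow_natCast, cocycle_inv hφ, cocycle_pow_of_eq_zero hφ hg n, smul_zero, neg_zero]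

/-! ## §2 Arithmetic in a basis `P₁, P₂` of `M ≅ (ℤ/q)²` -/

section Basis

variable {P₁ P₂ : M} {q : ℤ}

/-- `a • P = 0` when `q ∣ a` and `q • P = 0`. [folklore] -/
theorem zsmul_eq_zero_of_dvd {P : M} (hq : q • P = 0) {a : ℤ} (ha : q ∣ a) : a • P = 0 := by
  obtain ⟨k, rfl⟩ := ha
  rw [mul_comm, mul_smul, hq, smul_zero]

/-- Linear combinations with coefficients congruent mod `q` agree. [folklore] -/
theorem lincomb_congr (hqP₁ : q • P₁ = 0) (hqP₂ : q • P₂ = 0) {a b a' b' : ℤ}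
    (ha : q ∣ a - a') (hb : q ∣ b - b') : a • P₁ + b • P₂ = a' • P₁ + b' • P₂ := by
  rw [← sub_eq_zero]
  have : a • P₁ + b • P₂ - (a' • P₁ + b' • P₂) = (a - a') • P₁ + (b - b') • P₂ := by
    rw [sub_smul, sub_smul]; abel
  rw [this, zsmul_eq_zero_of_dvd hqP₁ ha, zsmul_eq_zero_of_dvd hqP₂ hb, add_zero]

/-- In `2M` the coefficients on the basis are even (`2 ∣ q`). [folklore] -/
theorem even_of_lincomb_eq_two_smul (h2q : (2 : ℤ) ∣ q) (hspan : ∀ m : M, ∃ a b : ℤ, m = a • P₁ + b • P₂)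
    (hindep : ∀ a b : ℤ, a • P₁ + b • P₂ = 0 → q ∣ a ∧ q ∣ b) {a b : ℤ} {y : M}
    (h : a • P₁ + b • P₂ = (2 : ℤ) • y) : (2 : ℤ) ∣ a ∧ (2 : ℤ) ∣ b := by
  obtain ⟨α, β, rfl⟩ := hspan y
  have h0 : (a - 2 * α) • P₁ + (b - 2 * β) • P₂ = 0 := by
    rw [sub_smul, sub_smul, mul_smul, mul_smul, ← sub_eq_zero.mpr h, smul_add]
    abel
  obtain ⟨h₁, h₂⟩ := hindep _ _ h0
  refine ⟨?_, ?_⟩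
  · have h := (h2q.trans h₁).add (dvd_mul_right 2 α)
    rwa [sub_add_cancel] at h
  · have h := (h2q.trans h₂).add (dvd_mul_right 2 β)
    rwa [sub_add_cancel] at h

/-- `P₁ ∉ 2M`. [folklore] -/
theorem basis_fst_ne_two_smul (h2q : (2 : ℤ) ∣ q) (hspan : ∀ m : M, ∃ a b : ℤ, m = a • P₁ + b • P₂)
    (hindep : ∀ a b : ℤ, a • P₁ + b • P₂ = 0 → q ∣ a ∧ q ∣ b) (y : M) : P₁ ≠ (2 : ℤ) • y := by
  intro h
  have h' : (1 : ℤ) • P₁ + (0 : ℤ) • P₂ = (2 : ℤ) • y := by rw [one_smul, zero_smul, add_zero]; exact h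
  have := (even_of_lincomb_eq_two_smul h2q hspan hindep h').1
  omega

/-- `P₂ ∉ 2M`. [folklore] -/
theorem basis_snd_ne_two_smul (h2q : (2 : ℤ) ∣ q) (hspan : ∀ m : M, ∃ a b : ℤ, m = a • P₁ + b • P₂)
    (hindep : ∀ a b : ℤ, a • P₁ + b • P₂ = 0 → q ∣ a ∧ q ∣ b) (y : M) : P₂ ≠ (2 : ℤ) • y := by
  intro h
  have h' : (0 : ℤ) • P₁ + (1 : ℤ) • P₂ = (2 : ℤ) • y := by rw [one_smul, zero_smul, zero_add]; exact h
  have := (even_of_lincomb_eq_two_smul h2q hspan hindep h').2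
  omega

/-- `P₁ - P₂ ∉ 2M`. [folklore] -/
theorem basis_sub_ne_two_smul (h2q : (2 : ℤ) ∣ q) (hspan : ∀ m : M, ∃ a b : ℤ, m = a • P₁ + b • P₂)
    (hindep : ∀ a b : ℤ, a • P₁ + b • P₂ = 0 → q ∣ a ∧ q ∣ b) (y : M) : P₁ - P₂ ≠ (2 : ℤ) • y := by
  intro h
  have h' : (1 : ℤ) • P₁ + (-1 : ℤ) • P₂ = (2 : ℤ) • y := by rw [one_smul, neg_one_zsmul, ← sub_eq_add_neg]; exact h
  have := (even_of_lincomb_eq_two_smul h2q hspan hindep h').1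
  omega

/-- Coefficients of a `2`-torsion element: `q ∣ 2a`, `q ∣ 2b`. [folklore] -/
theorem dvd_two_mul_of_two_smul_eq_zero
    (hindep : ∀ a b : ℤ, a • P₁ + b • P₂ = 0 → q ∣ a ∧ q ∣ b) {a b : ℤ}
    (hx : (2 : ℤ) • (a • P₁ + b • P₂) = 0) : q ∣ 2 * a ∧ q ∣ 2 * b := by
  have h2 : (2 * a) • P₁ + (2 * b) • P₂ = 0 := by rw [mul_smul, mul_smul, ← smul_add]; exact hx
  exact hindep _ _ h2

/-- An element of LAYER `i ≥ 1` (`v • P₁ = (1 + 2^i α) P₁ + 2^i γ P₂`, `v • P₂ = 2^i β P₁ + (1 + 2^i δ) P₂`) fixes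
every `2`-torsion element (`q = 2^L`). [folklore] -/
theorem smul_eq_self_of_layer (hqM : ∀ m : M, q • m = 0)
    (hspan : ∀ m : M, ∃ a b : ℤ, m = a • P₁ + b • P₂)
    (hindep : ∀ a b : ℤ, a • P₁ + b • P₂ = 0 → q ∣ a ∧ q ∣ b)
    {i : ℕ} (hi : 1 ≤ i) {v : Γ} {α β γ δ : ℤ} (hv₁ : v • P₁ = (1 + 2 ^ i * α) • P₁ + (2 ^ i * γ) • P₂)
    (hv₂ : v • P₂ = (2 ^ i * β) • P₁ + (1 + 2 ^ i * δ) • P₂) {x : M} (hx : (2 : ℤ) • x = 0) : v • x = x := by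
  obtain ⟨a, b, rfl⟩ := hspan x
  obtain ⟨ha, hb⟩ := dvd_two_mul_of_two_smul_eq_zero hindep hx
  obtain ⟨i', rfl⟩ : ∃ i', i = i' + 1 := ⟨i - 1, by omega⟩
  -- `q ∣ a * 2^i` and `q ∣ b * 2^i`
  have ha' : q ∣ a * 2 ^ (i' + 1) := by
    rw [show a * 2 ^ (i' + 1) = 2 * a * 2 ^ i' by ring]; exact ha.mul_right _
  have hb' : q ∣ b * 2 ^ (i' + 1) := by
    rw [show b * 2 ^ (i' + 1) = 2 * b * 2 ^ i' by ring]; exact hb.mul_right _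
  rw [smul_lincomb, hv₁, hv₂]
  have e : a • ((1 + 2 ^ (i' + 1) * α) • P₁ + (2 ^ (i' + 1) * γ) • P₂) +
      b • ((2 ^ (i' + 1) * β) • P₁ + (1 + 2 ^ (i' + 1) * δ) • P₂) =
      a • P₁ + b • P₂ + ((a * 2 ^ (i' + 1)) • (α • P₁ + γ • P₂) + (b * 2 ^ (i' + 1)) • (β • P₁ + δ • P₂)) := by
    module
  rw [e, zsmul_eq_zero_of_dvd (hqM _) ha', zsmul_eq_zero_of_dvd (hqM _) hb', add_zero, add_zero]

/-- `M^{u, ℓ} = 0` for the transvections `u : P₂ ↦ P₁ + P₂`, `ℓ : P₁ ↦ P₁ + P₂`. [folklore] -/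
theorem eq_zero_of_fixed_transvections (hspan : ∀ m : M, ∃ a b : ℤ, m = a • P₁ + b • P₂)
    (hindep : ∀ a b : ℤ, a • P₁ + b • P₂ = 0 → q ∣ a ∧ q ∣ b)
    (hqP₁ : q • P₁ = 0) (hqP₂ : q • P₂ = 0)
    {u ℓ : Γ} (huP₁ : u • P₁ = P₁) (huP₂ : u • P₂ = P₁ + P₂) (hℓP₁ : ℓ • P₁ = P₁ + P₂) (hℓP₂ : ℓ • P₂ = P₂)
    {x : M} (hux : u • x = x) (hℓx : ℓ • x = x) : x = 0 := by
  obtain ⟨a, b, rfl⟩ := hspan x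
  rw [smul_lincomb, huP₁, huP₂] at hux
  rw [smul_lincomb, hℓP₁, hℓP₂] at hℓx
  have hb0 : b • P₁ + (0 : ℤ) • P₂ = 0 := by
    rw [show b • P₁ + (0 : ℤ) • P₂ = a • P₁ + b • (P₁ + P₂) - (a • P₁ + b • P₂) by module, hux, sub_self]
  have ha0 : (0 : ℤ) • P₁ + a • P₂ = 0 := by
    rw [show (0 : ℤ) • P₁ + a • P₂ = a • (P₁ + P₂) + b • P₂ - (a • P₁ + b • P₂) by module, hℓx, sub_self]
  rw [zsmul_eq_zero_of_dvd hqP₁ (hindep _ _ ha0).2, zsmul_eq_zero_of_dvd hqP₂ (hindep _ _ hb0).1, add_zero]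

/-- `(r²)` has no non-zero fixed `2`-torsion vector when `r² : P₁ ↦ 5P₁ + 3P₂, P₂ ↦ 3P₁ + 2P₂`. [folklore] -/
theorem eq_zero_of_two_torsion_fixed_rr (hspan : ∀ m : M, ∃ a b : ℤ, m = a • P₁ + b • P₂)
    (hindep : ∀ a b : ℤ, a • P₁ + b • P₂ = 0 → q ∣ a ∧ q ∣ b)
    (hqP₁ : q • P₁ = 0) (hqP₂ : q • P₂ = 0)
    {g : Γ} (hg₁ : g • P₁ = (5 : ℤ) • P₁ + (3 : ℤ) • P₂) (hg₂ : g • P₂ = (3 : ℤ) • P₁ + (2 : ℤ) • P₂)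
    {x : M} (h2x : (2 : ℤ) • x = 0) (hx : g • x = x) : x = 0 := by
  obtain ⟨a, b, rfl⟩ := hspan x
  obtain ⟨ha, -⟩ := dvd_two_mul_of_two_smul_eq_zero hindep h2x
  rw [smul_lincomb, hg₁, hg₂] at hx
  have h0 : (4 * a + 3 * b) • P₁ + (3 * a + b) • P₂ = 0 := by
    rw [show (4 * a + 3 * b) • P₁ + (3 * a + b) • P₂ =
      a • ((5 : ℤ) • P₁ + (3 : ℤ) • P₂) + b • ((3 : ℤ) • P₁ + (2 : ℤ) • P₂) - (a • P₁ + b • P₂) by module, hx, sub_self]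
  obtain ⟨h₁, h₂⟩ := hindep _ _ h0
  -- `q ∣ 5a` from `3(3a+b) - (4a+3b) = 5a`; with `q ∣ 2a`: `q ∣ 5a - 2·2a = a`
  have h5 : q ∣ 5 * a := by
    have := (h₂.mul_left 3).sub h₁
    rwa [show 3 * (3 * a + b) - (4 * a + 3 * b) = 5 * a by ring] at this
  have hqa : q ∣ a := by
    have := h5.sub (ha.mul_left 2)
    rwa [show 5 * a - 2 * (2 * a) = a by ring] at this
  have hqb : q ∣ b := by
    have := h₂.sub (hqa.mul_left 3)
    rwa [show 3 * a + b - 3 * a = b by ring] at this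
  rw [zsmul_eq_zero_of_dvd hqP₁ hqa, zsmul_eq_zero_of_dvd hqP₂ hqb, add_zero]

end Basis

end Summit.BirchSwinnertonDyer.BirchSwinnertonDyer.Theorems.GenusExact.NonPhantomPow
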